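import Summits.ABC.StewartYu.PadicG3TwoSlabFunctions
import Summits.ABC.StewartYu.PadicG3TwoSeries
import HarnessLib

/-!
# Cell abc-stewartyu, Gen-3 frame at `p = 2` (crux `Y07Two`, stmt-ABC-19659), layer F4a-SLAB: the slab family
# `G_τ` as POWER SERIES of radius `4·2^m` — coefficients, the weighted bound, jets

`Summits/ABC/StewartYu/PadicG3TwoSlabSeries.lean` — cell `abc-stewartyu` (HOME `run/shared/lean/pub/abc-stewartyu/`),
route `PadicPrimesKummerThird`, seat p3 (g5), F-two LEAD (design of record D-F2).  Definitions and theorems on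
`TwoSetup`; twin of `PadicG3TwoSeries.lean` (the case `m = 0`) for the slab family `g3G` of
`PadicG3TwoSlabFunctions` (exponent differences `‖δᵢ‖ ≤ 2^{−(m+3)}`): `G_τ(z) = ∑ₙ coeffG3G n · zⁿ` on
`‖z‖ < 4·2^m` (`hasSum_coeffG3G`), with the weighted bound `‖coeffG3G n‖·(4·2^m)ⁿ ≤ Bw`
(`wtBdd_coeffG3G`) from the frame's `Y₀`-weight bound `‖coeffₖ(Hasse_{t₀} Rᵢ)‖·(4·2^m)ᵏ ≤ Bw` (the price of
the slab: the `Y₀`-line of the ledger) and `‖δᵢʲ/j!‖·(4·2^m)ʲ ≤ 1`; jets controlled by values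
(`norm_jet_g3G_le`) — the inputs of the small-jets Schwarz lemma at radius `ρ = 4·2^m`, i.e. gain
`(m+2)·log 2` per zero at the integer nodes.

WHAT THIS IS NOT: no Schwarz step (sequel `PadicG3TwoSlabKStep`); no crux moves.

References: K. Yu, Acta Arith. 89 (1999) §2; K. Yu, Acta Math. 211 (2013), Lemma 5.2; Yu 1990 Lemmas 2.2–2.4.
-/

noncomputable section

open NormedSpace Finset IsUltrametricDist Polynomial Metric Filter
open Literature.NumberTheory.Transcendental
open Literature.NumberTheory.Transcendental.CW77.Setup (Tau tauNorm)
open scoped Nat Topology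

namespace Summit.ABC.StewartYu

namespace TwoSetup

variable (S : TwoSetup) {ι : Type*} (R : ι → ℚ[X]) (u : ι → Fin S.d → ℤ) (uθ : ι → ℤ)

/-! ### The coefficients -/

/-- The coefficients of `exp(δᵢ·z)`: `δᵢ^j / j!`. [cite: Yu1990, §1.1] -/
def g3GeC (i₀ i : ι) (j : ℕ) : ℚ_[2] := S.δexpo u uθ i₀ i ^ j / (j ! : ℚ_[2])

/-- **The coefficient sequence of `G_τ`**:
`coeffG3G n = ∑_i pᵢ · ∏ zγⱼ^{tⱼ} · ∑_{k ≤ deg, k ≤ n} g3wC k · g3GeC (n − k)`. [cite: Yu1990, Lemma 2.2] -/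
def coeffG3G (B : Finset ι) (p : ι → ℤ) (i₀ : ι) (τ : Tau S.d) (n : ℕ) : ℚ_[2] :=
  ∑ i ∈ B, (p i : ℚ_[2]) * (S.zγpow u uθ i τ.2 : ℚ_[2]) *
    ∑ k ∈ range (g3wDeg R i τ.1 + 1), if k ≤ n then g3wC R i τ.1 k * S.g3GeC u uθ i₀ i (n - k) else 0

/-! ### Convergence to `G_τ` on `‖z‖ < 4·2^m` -/

/-- `exp(δᵢ·z) = ∑ⱼ g3GeC j zʲ` for `‖δᵢ‖ ≤ 2^{−(m+3)}`, `‖z‖ < 4·2^m`. [cite: Yu1990, §1.1] -/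
theorem hasSum_g3GeC (i₀ i : ι) {m : ℕ} (hδ : ‖S.δexpo u uθ i₀ i‖ ≤ ((2 : ℝ) ^ (m + 3))⁻¹)
    {z : ℚ_[2]} (hz : ‖z‖ < 4 * (2 : ℝ) ^ m) :
    HasSum (fun j => S.g3GeC u uθ i₀ i j * z ^ j) (exp (S.δexpo u uθ i₀ i * z)) := by
  have hcz : ‖S.δexpo u uθ i₀ i * z‖ < ((2 : ℕ) : ℝ)⁻¹ := norm_mul_lt_half_slab hδ hz
  have hmem : S.δexpo u uθ i₀ i * z ∈ eball (0 : ℚ_[2]) (expSeries ℚ_[2] ℚ_[2]).radius := by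
    have := PadicExp.mem_eball (ℓ := 2) (E := ℚ_[2]) hcz
    simpa [smul_eq_mul] using this
  have h := expSeries_hasSum_exp_of_mem_ball' (𝕂 := ℚ_[2]) (S.δexpo u uθ i₀ i * z) hmem
  refine h.congr_fun fun j => ?_
  rw [inv_natCast_smul_eq ℚ_[2] ℚ_[2], smul_eq_mul, g3GeC, mul_pow]
  field_simp

/-- One shifted series for the slab family (`‖z‖ < 4·2^m`). [cite: Yu1990, Lemma 2.2] -/
theorem hasSum_g3Gshift (i₀ i : ι) {m : ℕ} (hδ : ‖S.δexpo u uθ i₀ i‖ ≤ ((2 : ℝ) ^ (m + 3))⁻¹)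
    (t₀ k : ℕ) {z : ℚ_[2]} (hz : ‖z‖ < 4 * (2 : ℝ) ^ m) :
    HasSum (fun n => (if k ≤ n then g3wC R i t₀ k * S.g3GeC u uθ i₀ i (n - k) else 0) * z ^ n)
      (g3wC R i t₀ k * z ^ k * exp (S.δexpo u uθ i₀ i * z)) := by
  have h := (S.hasSum_g3GeC u uθ i₀ i hδ hz).mul_left (g3wC R i t₀ k * z ^ k)
  rw [← hasSum_nat_add_iff' k]
  have h0 : ∑ n ∈ range k, (if k ≤ n then g3wC R i t₀ k * S.g3GeC u uθ i₀ i (n - k) else 0) * z ^ n = 0 :=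
    sum_eq_zero fun n hn => by rw [if_neg (by have := mem_range.mp hn; omega), zero_mul]
  rw [h0, sub_zero]
  refine h.congr_fun fun n => ?_
  rw [if_pos (by omega), Nat.add_sub_cancel, pow_add]
  ring

/-- One term: `∑ₙ (∑ₖ [k ≤ n] g3wC k g3GeC (n−k)) zⁿ = (hw i t₀)(z) · exp(δᵢ z)` (`‖z‖ < 4·2^m`).
[cite: Yu1990, Lemma 2.2] -/
theorem hasSum_g3Gterm (i₀ i : ι) {m : ℕ} (hδ : ‖S.δexpo u uθ i₀ i‖ ≤ ((2 : ℝ) ^ (m + 3))⁻¹)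
    (τ : Tau S.d) {z : ℚ_[2]} (hz : ‖z‖ < 4 * (2 : ℝ) ^ m) :
    HasSum (fun n => (∑ k ∈ range (g3wDeg R i τ.1 + 1),
        (if k ≤ n then g3wC R i τ.1 k * S.g3GeC u uθ i₀ i (n - k) else 0)) * z ^ n)
      ((hw R i τ.1).eval z * exp (S.δexpo u uθ i₀ i * z)) := by
  have h := hasSum_sum fun k (_ : k ∈ range (g3wDeg R i τ.1 + 1)) =>
    S.hasSum_g3Gshift R u uθ i₀ i hδ τ.1 k hz
  rw [hw_eval_eq_sum, sum_mul]
  refine h.congr_fun fun n => ?_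
  rw [sum_mul]

/-- **`G_τ(z) = ∑ₙ coeffG3G n zⁿ` on `‖z‖ < 4·2^m`.** [cite: Yu1990, Lemma 2.2] -/
theorem hasSum_coeffG3G (B : Finset ι) (p : ι → ℤ) (i₀ : ι) {m : ℕ}
    (hslab : ∀ i ∈ B, ‖S.δexpo u uθ i₀ i‖ ≤ ((2 : ℝ) ^ (m + 3))⁻¹) (τ : Tau S.d) {z : ℚ_[2]}
    (hz : ‖z‖ < 4 * (2 : ℝ) ^ m) :
    HasSum (fun n => S.coeffG3G R u uθ B p i₀ τ n * z ^ n) (S.g3G R u uθ B p i₀ τ z) := by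
  unfold g3G coeffG3G
  have h := hasSum_sum fun i (hi : i ∈ B) =>
    (S.hasSum_g3Gterm R u uθ i₀ i (hslab i hi) τ hz).mul_left ((p i : ℚ_[2]) * (S.zγpow u uθ i τ.2 : ℚ_[2]))
  have e : ∑ i ∈ B, (p i : ℚ_[2]) * (S.zγpow u uθ i τ.2 : ℚ_[2]) *
      ((hw R i τ.1).eval z * exp (S.δexpo u uθ i₀ i * z)) =
      ∑ i ∈ B, (p i : ℚ_[2]) * S.g3termG R u uθ i₀ i τ z :=
    sum_congr rfl fun i _ => by simp only [g3termG]; ring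
  rw [← e]
  refine h.congr_fun fun n => ?_
  rw [sum_mul]
  exact sum_congr rfl fun i _ => by ring

/-- `G_τ(z) = ∑' coeffG3G n zⁿ` on `‖z‖ < 4·2^m`. [cite: Yu1990, Lemma 2.2] -/
theorem g3G_eq_tsum (B : Finset ι) (p : ι → ℤ) (i₀ : ι) {m : ℕ}
    (hslab : ∀ i ∈ B, ‖S.δexpo u uθ i₀ i‖ ≤ ((2 : ℝ) ^ (m + 3))⁻¹) (τ : Tau S.d) {z : ℚ_[2]}
    (hz : ‖z‖ < 4 * (2 : ℝ) ^ m) :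
    S.g3G R u uθ B p i₀ τ z = ∑' n, S.coeffG3G R u uθ B p i₀ τ n * z ^ n :=
  (S.hasSum_coeffG3G R u uθ B p i₀ hslab τ hz).tsum_eq.symm

/-- `G_τ` agrees with its power series near every point of `‖z‖ < 4·2^m`. [cite: Yu1990, Lemma 2.2] -/
theorem g3G_eventuallyEq_tsum (B : Finset ι) (p : ι → ℤ) (i₀ : ι) {m : ℕ}
    (hslab : ∀ i ∈ B, ‖S.δexpo u uθ i₀ i‖ ≤ ((2 : ℝ) ^ (m + 3))⁻¹) (τ : Tau S.d) {a : ℚ_[2]}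
    (ha : ‖a‖ < 4 * (2 : ℝ) ^ m) :
    S.g3G R u uθ B p i₀ τ =ᶠ[𝓝 a] fun z => ∑' n, S.coeffG3G R u uθ B p i₀ τ n * z ^ n := by
  have hball : {z : ℚ_[2] | ‖z‖ < 4 * (2 : ℝ) ^ m} ∈ 𝓝 a := by
    have : {z : ℚ_[2] | ‖z‖ < 4 * (2 : ℝ) ^ m} = Metric.ball 0 (4 * (2 : ℝ) ^ m) := by
      ext z; simp
    rw [this]
    exact Metric.isOpen_ball.mem_nhds (by simpa using ha)
  filter_upwards [hball] with z hz using S.g3G_eq_tsum R u uθ B p i₀ hslab τ hz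

/-! ### The weighted bound `‖coeffG3G n‖ (4·2^m)ⁿ ≤ Bw` -/

/-- `‖g3GeC j‖·(4·2^m)ʲ ≤ 1` (`‖δᵢ‖ ≤ 2^{−(m+3)}`, `‖1/j!‖₂ ≤ 2ʲ`, `2^{−(m+3)}·2·4·2^m = 1`).
[cite: Yu1999, §2; shape only] -/
theorem norm_g3GeC_mul_le (i₀ i : ι) {m : ℕ} (hδ : ‖S.δexpo u uθ i₀ i‖ ≤ ((2 : ℝ) ^ (m + 3))⁻¹)
    (j : ℕ) : ‖S.g3GeC u uθ i₀ i j‖ * (4 * (2 : ℝ) ^ m) ^ j ≤ 1 := by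
  unfold g3GeC
  rw [div_eq_mul_inv, norm_mul, norm_pow, show ((j ! : ℚ_[2])) = ((j ! : ℕ) : ℚ_[2]) by norm_cast]
  have h1 : ‖S.δexpo u uθ i₀ i‖ ^ j ≤ (((2 : ℝ) ^ (m + 3))⁻¹) ^ j :=
    pow_le_pow_left₀ (norm_nonneg _) hδ j
  have h2 := norm_inv_factorial_le_two_pow j
  have hkey : ((2 : ℝ) ^ (m + 3))⁻¹ * 2 * (4 * (2 : ℝ) ^ m) = 1 := by
    rw [pow_add]; field_simp; norm_num
  calc ‖S.δexpo u uθ i₀ i‖ ^ j * ‖((j ! : ℕ) : ℚ_[2])⁻¹‖ * (4 * (2 : ℝ) ^ m) ^ j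
      ≤ (((2 : ℝ) ^ (m + 3))⁻¹) ^ j * (2 : ℝ) ^ j * (4 * (2 : ℝ) ^ m) ^ j := by
        refine mul_le_mul_of_nonneg_right (mul_le_mul h1 h2 (norm_nonneg _) (by positivity)) ?_
        positivity
    _ = (((2 : ℝ) ^ (m + 3))⁻¹ * 2 * (4 * (2 : ℝ) ^ m)) ^ j := by rw [← mul_pow, ← mul_pow]
    _ = 1 := by rw [hkey, one_pow]

/-- **The weighted coefficient bound at radius `4·2^m`**: if `‖coeffₖ(hw i t₀)‖·(4·2^m)ᵏ ≤ Bw` for all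
`i ∈ B`, `k`, then `WtBdd (4·2^m) Bw coeffG3G`. [cite: Yu1990, Lemma 2.2] -/
theorem wtBdd_coeffG3G (B : Finset ι) (p : ι → ℤ) (i₀ : ι) {m : ℕ}
    (hslab : ∀ i ∈ B, ‖S.δexpo u uθ i₀ i‖ ≤ ((2 : ℝ) ^ (m + 3))⁻¹) (τ : Tau S.d) {Bw : ℝ}
    (hBw0 : 0 ≤ Bw) (hBw : ∀ i ∈ B, ∀ k, ‖(hw R i τ.1).coeff k‖ * (4 * (2 : ℝ) ^ m) ^ k ≤ Bw) :
    PadicNewton.WtBdd (4 * (2 : ℝ) ^ m) Bw (S.coeffG3G R u uθ B p i₀ τ) := by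
  intro n
  have hsp : (0 : ℝ) < (4 * (2 : ℝ) ^ m) ^ n := pow_pos (by positivity) n
  rw [← le_div_iff₀ hsp]
  have hB : 0 ≤ Bw / (4 * (2 : ℝ) ^ m) ^ n := by positivity
  unfold coeffG3G
  refine norm_sum_le_of_forall_le_of_nonneg hB fun i hi => ?_
  rw [norm_mul, norm_mul]
  refine (mul_le_of_le_one_left (norm_nonneg _)
    (mul_le_one₀ (Padic.norm_int_le_one _) (norm_nonneg _) (S.norm_zγpow_le u uθ i τ.2))).trans ?_
  refine norm_sum_le_of_forall_le_of_nonneg hB fun k _ => ?_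
  split_ifs with hkn
  · rw [le_div_iff₀ hsp, norm_mul]
    have e : (4 * (2 : ℝ) ^ m) ^ n = (4 * (2 : ℝ) ^ m) ^ k * (4 * (2 : ℝ) ^ m) ^ (n - k) := by
      rw [← pow_add, Nat.add_sub_cancel' hkn]
    rw [e]
    calc ‖g3wC R i τ.1 k‖ * ‖S.g3GeC u uθ i₀ i (n - k)‖ * ((4 * (2 : ℝ) ^ m) ^ k * (4 * (2 : ℝ) ^ m) ^ (n - k))
        = (‖g3wC R i τ.1 k‖ * (4 * (2 : ℝ) ^ m) ^ k) *
            (‖S.g3GeC u uθ i₀ i (n - k)‖ * (4 * (2 : ℝ) ^ m) ^ (n - k)) := by ring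
      _ ≤ Bw * 1 :=
          mul_le_mul (hBw i hi k) (S.norm_g3GeC_mul_le u uθ i₀ i (hslab i hi) (n - k)) (by positivity) hBw0
      _ = Bw := mul_one _
  · rw [norm_zero]; exact hB

/-! ### Jets of `G_τ` from the values of the family -/

/-- **The jets of `G_τ` at a node are controlled by the values of the slab family there**: if
`‖G_τ'(a)‖ ≤ ε` for all `|τ'| ≤ N` (`‖a‖ ≤ 2`), then for `|τ| + k ≤ N` the `k`-th jet of the power series of
`G_τ` at `a` has norm `≤ ‖(k!)⁻¹‖₂·ε`. [cite: Yu1990, Lemma 2.4] -/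
theorem norm_jet_g3G_le (B : Finset ι) (p : ι → ℤ) (i₀ : ι) {m : ℕ}
    (hslab : ∀ i ∈ B, ‖S.δexpo u uθ i₀ i‖ ≤ ((2 : ℝ) ^ (m + 3))⁻¹) {Bw : ℝ} (hBw0 : 0 ≤ Bw)
    {a : ℚ_[2]} (ha : ‖a‖ ≤ 2) (N : ℕ) {ε : ℝ} (hε0 : 0 ≤ ε)
    (hε : ∀ τ : Tau S.d, tauNorm τ ≤ N → ‖S.g3G R u uθ B p i₀ τ a‖ ≤ ε)
    (k : ℕ) (τ : Tau S.d)
    (hBw : ∀ i ∈ B, ∀ k', ‖(hw R i τ.1).coeff k'‖ * (4 * (2 : ℝ) ^ m) ^ k' ≤ Bw)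
    (hk : tauNorm τ + k ≤ N) :
    ‖PadicNewton.jet a (S.coeffG3G R u uθ B p i₀ τ) k‖ ≤ ‖((k ! : ℕ) : ℚ_[2])⁻¹‖ * ε := by
  have h2m : (2 : ℝ) < 4 * (2 : ℝ) ^ m := by
    have : (1 : ℝ) ≤ 2 ^ m := one_le_pow₀ (by norm_num)
    nlinarith
  have ha' : ‖a‖ < 4 * (2 : ℝ) ^ m := lt_of_le_of_lt ha h2m
  have hb := S.wtBdd_coeffG3G R u uθ B p i₀ hslab τ hBw0 hBw
  have hj := PadicNewton.norm_jet_le_norm_iteratedDeriv (by positivity : (0 : ℝ) < 4 * (2 : ℝ) ^ m)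
    h2m two_pos hb ha k
  refine hj.trans (mul_le_mul_of_nonneg_left ?_ (norm_nonneg _))
  rw [← (S.g3G_eventuallyEq_tsum R u uθ B p i₀ hslab τ ha').iteratedDeriv_eq k]
  exact S.norm_iteratedDeriv_g3G_le_of_forall R u uθ B p i₀ hslab ha' N hε0 hε k τ hk

end TwoSetup

end Summit.ABC.StewartYu

end
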